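import Summits.AtomisticToContinuum.Crystallization.Theses.EnergyDerivativeOrder
import Summits.AtomisticToContinuum.Crystallization.Theorems.ChargedEnergyGap.Negative.BlocksBound
import Literature.MathematicalPhysics.StatisticalMechanics.LennardJonesThermodynamicLimitProofs

/-!
# Route EnergyDerivativeOrder — item `TrialUpperBound` (stmt-AtomisticToContinuum-12280)

The trial-state upper bound per periodic competitor for the Lennard-Jones gas in `ℝ³`:
for every periodic configuration `Q` and every `ε > 0`, eventually in `N`,
`E(N)/N ≤ e(Q) + ε`.

Proof: the thermodynamic limit `BlancLewin2015_8_holds` (Blanc–Lewin 2015 §1.3 (8):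
`E(N)/N → e_∞` for `1 ≤ d ≤ 5`, proved in the tree by subadditivity) and the blocks-of-`Q`
trial-state bound `le_energyPerParticle_of_tendsto` (`e_∞ ≤ e(Q)`: finite blocks of a periodic
configuration are admissible trial states whose boundary losses are `o(K³)`, the cut `r⁻⁶` tail
being summable in `d = 3`) put `E(N)/N` eventually below `e_∞ + ε ≤ e(Q) + ε`.
The statement coincides (up to binder grouping) with `ThreeConeCertificate.TrialStateUpper`,
proved the same way in `Theorems/ThreeConeCertificateTrialStateUpper.lean`. [folklore;
BlancLewin2015 §1.3 (8), §2.1]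
-/

noncomputable section

namespace Summit.AtomisticToContinuum.Crystallization.Theorems

open Literature.MathematicalPhysics.StatisticalMechanics
open Summit.AtomisticToContinuum.Crystallization.Theorems.ChargedEnergyGapNegative

/-- **Trial-state upper bound, one periodic competitor at a time** (item
`stmt-AtomisticToContinuum-12280`, route decl `EnergyDerivativeOrder.TrialUpperBound`): for every
periodic configuration `Q` of `ℝ³` and every `ε > 0`, eventually
`E(N)/N ≤ Q.energyPerParticle lennardJones + ε` for the Lennard-Jones ground-state energy `E(N)`.
From `BlancLewin2015_8_holds` (`E(N)/N → e_∞`) and `le_energyPerParticle_of_tendsto`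
(`e_∞ ≤ e(Q)`). [folklore; BlancLewin2015 §1.3 (8), §2.1] -/
theorem trialUpperBound_proof :
    Summit.AtomisticToContinuum.Crystallization.Theses.EnergyDerivativeOrder.TrialUpperBound := by
  unfold Summit.AtomisticToContinuum.Crystallization.Theses.EnergyDerivativeOrder.TrialUpperBound
  intro Q ε hε
  -- the thermodynamic limit `e_∞` of `E(N)/N` in dimension 3
  obtain ⟨e, -, htend, -⟩ := BlancLewin2015_8_holds 3 (by norm_num) (by norm_num)
  -- blocks of `Q` as trial states: `e_∞ ≤ e(Q)`
  have hle : e ≤ Q.energyPerParticle lennardJones := le_energyPerParticle_of_tendsto htend Q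
  have hlt : e < Q.energyPerParticle lennardJones + ε := by linarith
  filter_upwards [htend.eventually (gt_mem_nhds hlt)] with N hN
  exact hN.le

end Summit.AtomisticToContinuum.Crystallization.Theorems

end
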